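import Summits.QuantumFields.YangMills.Theorems.ParabolicTrajectoryLatticeGapOnTrajectoryTransferReduction
import Literature.MathematicalPhysics.QuantumFieldTheory.SpeciesTimeReflection
import HarnessLib

/-!
# Crux `LatticeGapOnTrajectory` (stmt-QuantumFields-10523), line `orbit-kantorovich-finite-size`:
# lattice representatives of slab-ordered product test functions (transfer half, A2)

Helper file (`--supports stmt-QuantumFields-10523`) for the registered stub `stub_transfer`, first
of the files proving the bridge `TorusOSGap → transfer clause` (sequel `…TransferFromOSGap`).
Everything here is on the LATTICE side of `IsYangMillsFor`, for ONE scheme `S` with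
time-reflection-symmetric witness renormalisations (`SpeciesScheme.IsReflectionSymmetric`):
* `obsProd S k σ f` — the product `∏ⱼ Φ^{σⱼ}_{a_k}(fⱼ)(Ũ)` of smeared renormalised lattice fields
  on the periodic lift `Ũ` (the integrand of `latticeSchwinger`; measurable, bounded);
  `timeShift Sd m` — the torus time translation `(τ_m U)(x, i) = U(x + m e₀, i)` of
  `latticeConnectedCorr` (`torusLift_timeShift`);
* the pointwise identities of the transfer argument: REFLECTION `Φ^{s}(θf)(Ũ) = Φ^{Θs}(f)((Θ'U)~)`
  for symmetric renormalisations (`smearedLatticeField_thetaTest_torusLift`,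
  `prod_smearedLatticeField_reflected`), TRANSLATION `Φ(T_{a s} g)(Ũ) = Φ(g)((τ_s U)~)` once the
  translated slab still fits in the box (`smearedLatticeField_translateTest_torusLift`), SUPPORT:
  a field smeared with `f` supported in `lo ≤ x⁰ ≤ hi`, `lo ≥ a (R + 1)` (`R` the time radius of
  the species) depends only on the links at lattice times `1 … w`, `a w ≥ hi + a R`
  (`dependsOn_smearedLatticeField_torusLift`);
* the limits `k → ∞` under `IsYangMillsFor r S T` for slab-ordered real product tensors `P, Q`:
  `tendsto_latticeSchwinger` (degree `0` by E0), `tendsto_integral_obsProd`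
  (`∫ X_Q → 𝔖_m^{σ'}(Q)`), `tendsto_integral_obsProd_reflected` (`∫ X_P → 𝔖_n^{Θσ∘rev}(ΘP*)`) and
  `tendsto_integral_obsProd_reflect_mul_shift`
  (`∫ X_P(Θ'U) X_Q(τ_{t/a_k}U) dμ_k → 𝔖_{n+m}^{Θσ∘rev ++ σ'}(ΘP* ⊗ T_t Q)`; the append tensor is an
  off-diagonal real product tensor, which is all `IsYangMillsFor` constrains).

References: Osterwalder–Seiler 1978 §2; Glimm–Jaffe 1987 §6.1; `…TransferReduction`,
`SpeciesTimeReflection`.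
-/

open scoped SchwartzMap Topology ComplexConjugate
open Filter Set MeasureTheory
open Literature.Probability.LatticeModels (box mem_box Torus.proj Torus.proj_apply)
open Literature.MathematicalPhysics.AQFT Literature.MathematicalPhysics.QuantumLattice
open Literature.MathematicalPhysics.QuantumFieldTheory

noncomputable section

namespace Summit.QuantumFields.YangMills.Cruxes.LatticeGapOnTrajectory.OrbitKantorovichFiniteSize

namespace Transfer

/-! ## §1 Products of smeared lattice fields on the torus -/

section Obs

variable {G : Type} [Group G] [MeasurableSpace G]

/-- The **time radius** of a species: the largest `|x⁰|` over the base points of its support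
edges. [folklore] -/
def timeRadius (s : YMSpecies G) : ℕ := s.supp.sup fun e => (e.1 0).natAbs

/-- Every support edge of `s` has `|x⁰| ≤ timeRadius s`. [folklore] -/
theorem abs_le_timeRadius (s : YMSpecies G)
    {e : Literature.MathematicalPhysics.QuantumLattice.ZdEdge 4} (he : e ∈ s.supp) :
    |e.1 0| ≤ (timeRadius s : ℤ) := by
  rw [← Int.natCast_natAbs]
  exact_mod_cast Finset.le_sup
    (f := fun e : Literature.MathematicalPhysics.QuantumLattice.ZdEdge 4 => (e.1 0).natAbs) he

/-- **The lattice representative of a real product tensor**: the product `∏ⱼ Φ^{σⱼ}_{a_k}(fⱼ)(Ũ)`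
of the smeared renormalised fields of the species string `σ` at step `k` of `S`, read on the
periodic lift `Ũ` of the torus configuration `U` (the integrand of `latticeSchwinger`). [cite: JaffeWitten2000, §6] -/
def obsProd (S : SpeciesScheme (YMSpecies G)) (k : ℕ) {n : ℕ} (σ : Fin n → YMSpecies G)
    (f : Fin n → 𝓢(EuclideanSpace ℝ (Fin 4), ℝ)) (U : GaugeConfig 4 (S.side k) G) : ℝ :=
  ∏ j, smearedLatticeField (σ j).F (box 4 (S.L k)) (S.a k) (S.c (σ j) k) (S.m (σ j) k) (f j)
    (torusLift (S.side k) U)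

/-- **The torus time translation** by `m` lattice units, `(τ_m U)(x, i) = U(x + m e₀, i)` — the
translation of `latticeConnectedCorr` (`torusLift_timeShift`), as a measurable equivalence
(tree `torusConfigShift` by `-m e₀ mod Sd`). [cite: OsterwalderSeiler1978, §2] -/
def timeShift (Sd m : ℕ) : GaugeConfig 4 Sd G ≃ᵐ GaugeConfig 4 Sd G :=
  torusConfigShift (Torus.proj Sd (-(Pi.single 0 (m : ℤ))))

omit [Group G] in
/-- The periodic lift of `τ_m U` is the `ℤ⁴`-translate `configShift (-m e₀)` of the lift of `U`
(the convention of `latticeConnectedCorr`). [folklore] -/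
theorem torusLift_timeShift (Sd m : ℕ) (U : GaugeConfig 4 Sd G) :
    torusLift Sd (timeShift Sd m U) = configShift (-(Pi.single 0 (m : ℤ))) (torusLift Sd U) := by
  have h := congrFun (toTorusObservable_comp_configShift Sd
    (-(Pi.single (0 : Fin 4) (m : ℤ) : Literature.Probability.LatticeModels.Site 4))
    (id : LGConfig 4 G → LGConfig 4 G)) U
  simp only [toTorusObservable, Function.comp_apply, id_eq] at h
  unfold timeShift
  exact h.symm

omit [Group G] in
/-- `τ_0 = id`. [folklore] -/
@[simp] theorem timeShift_zero_apply (Sd : ℕ) (U : GaugeConfig 4 Sd G) : timeShift Sd 0 U = U := by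
  have h0 : Torus.proj Sd (0 : Literature.Probability.LatticeModels.Site 4) = 0 := by funext i; simp
  funext e; simp [timeShift, torusConfigShift_apply, h0]

/-- A smeared lattice field read on the periodic lift is measurable in the torus configuration.
[folklore] -/
theorem measurable_smearedLatticeField_torusLift (s : YMSpecies G)
    (Λ : Finset (Literature.Probability.LatticeModels.Site 4)) (a c m : ℝ)
    (f : 𝓢(EuclideanSpace ℝ (Fin 4), ℝ)) (Sd : ℕ) :
    Measurable fun U : GaugeConfig 4 Sd G => smearedLatticeField s.F Λ a c m f (torusLift Sd U) := by
  unfold smearedLatticeField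
  refine (Finset.measurable_sum _ fun x _ => ?_).const_mul _
  exact ((s.measurable.comp ((configShift _).measurable.comp (measurable_torusLift _))).sub_const
    _).const_mul _

omit [Group G] in
/-- A smeared lattice field of a bounded observable is bounded. [folklore] -/
theorem exists_bound_smearedLatticeField {O : LGConfig 4 G → ℝ} (hO : ∃ C, ∀ U, |O U| ≤ C)
    (Λ : Finset (Literature.Probability.LatticeModels.Site 4)) (a c m : ℝ)
    (f : 𝓢(EuclideanSpace ℝ (Fin 4), ℝ)) : ∃ B, ∀ V, |smearedLatticeField O Λ a c m f V| ≤ B := by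
  obtain ⟨C, hC⟩ := hO
  refine ⟨|c * a ^ 4| * ∑ x ∈ Λ, |f (a • siteToE x)| * (C + |m|), fun V => ?_⟩
  unfold smearedLatticeField
  rw [abs_mul]
  refine mul_le_mul_of_nonneg_left ((Finset.abs_sum_le_sum_abs _ _).trans
    (Finset.sum_le_sum fun x _ => ?_)) (abs_nonneg _)
  rw [abs_mul]
  exact mul_le_mul_of_nonneg_left ((abs_sub _ _).trans (add_le_add (hC _) le_rfl)) (abs_nonneg _)

/-- `obsProd` is measurable. [folklore] -/
theorem measurable_obsProd (S : SpeciesScheme (YMSpecies G)) (k : ℕ) {n : ℕ}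
    (σ : Fin n → YMSpecies G) (f : Fin n → 𝓢(EuclideanSpace ℝ (Fin 4), ℝ)) :
    Measurable (obsProd S k σ f) :=
  Finset.measurable_prod _ fun j _ =>
    measurable_smearedLatticeField_torusLift (σ j) _ _ _ _ (f j) _

/-- `obsProd` is bounded. [folklore] -/
theorem exists_bound_obsProd (S : SpeciesScheme (YMSpecies G)) (k : ℕ) {n : ℕ}
    (σ : Fin n → YMSpecies G) (f : Fin n → 𝓢(EuclideanSpace ℝ (Fin 4), ℝ)) :
    ∃ B, ∀ U, |obsProd S k σ f U| ≤ B := by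
  choose B hB using fun j => exists_bound_smearedLatticeField (σ j).bounded (box 4 (S.L k)) (S.a k)
    (S.c (σ j) k) (S.m (σ j) k) (f j)
  refine ⟨∏ j, B j, fun U => ?_⟩
  rw [obsProd, Finset.abs_prod]
  exact Finset.prod_le_prod (fun j _ => abs_nonneg _) fun j _ => hB j _

/-- **Support.** A field smeared with `f` supported in the slab `lo ≤ x⁰ ≤ hi`, `a (R + 1) ≤ lo`,
`hi + a R ≤ a w < a · Sd` (`R` the time radius of the species) depends only on the torus links
based at lattice times `1, …, w`. [cite: OsterwalderSeiler1978, §2] -/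
theorem dependsOn_smearedLatticeField_torusLift (s : YMSpecies G) (L : ℕ) {a : ℝ} (ha : 0 < a)
    (c m : ℝ) {f : 𝓢(EuclideanSpace ℝ (Fin 4), ℝ)} {lo hi : ℝ}
    (hsupp : tsupport (f : EuclideanSpace ℝ (Fin 4) → ℝ) ⊆ {x | lo ≤ x 0 ∧ x 0 ≤ hi}) {w : ℕ}
    (hlo : a * (timeRadius s + 1) ≤ lo) (hhi : hi + a * timeRadius s ≤ a * w) {Sd : ℕ} [NeZero Sd]
    (hw : w < Sd) :
    DependsOn (fun U : GaugeConfig 4 Sd G => smearedLatticeField s.F (box 4 L) a c m f (torusLift Sd U))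
      {e | 1 ≤ (e.1 0).val ∧ (e.1 0).val ≤ w} := by
  intro U V hUV
  simp only [smearedLatticeField]
  refine congrArg (fun z : ℝ => c * a ^ 4 * z) (Finset.sum_congr rfl fun x _ => ?_)
  by_cases hx : f (a • siteToE x) = 0
  · simp [hx]
  have hx' := hsupp (subset_tsupport _ (Function.mem_support.2 hx))
  simp only [Set.mem_setOf_eq, PiLp.smul_apply, siteToE_apply, smul_eq_mul] at hx'
  have h1 : (timeRadius s : ℝ) + 1 ≤ (x 0 : ℝ) :=
    le_of_mul_le_mul_left (hlo.trans hx'.1) ha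
  have h2 : (x 0 : ℝ) + timeRadius s ≤ w := by
    refine le_of_mul_le_mul_left ?_ ha
    nlinarith [hx'.2, hhi]
  have h1' : (timeRadius s : ℤ) + 1 ≤ x 0 := by exact_mod_cast h1
  have h2' : x 0 + (timeRadius s : ℤ) ≤ w := by exact_mod_cast h2
  have hO : s.F (configShift (-x) (torusLift Sd U)) = s.F (configShift (-x) (torusLift Sd V)) := by
    refine s.isCylinder fun e he => ?_
    simp only [configShift_apply, torusLift, Function.comp_apply]
    refine hUV _ ?_
    have hR := abs_le.1 (abs_le_timeRadius s he)
    have hz : (1 : ℤ) ≤ (e.1 - -x) 0 ∧ (e.1 - -x) 0 ≤ w := by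
      simp only [Pi.sub_apply, Pi.neg_apply]
      constructor <;> omega
    have hw' : (w : ℤ) < Sd := by exact_mod_cast hw
    have hval : ((((e.1 - -x) 0 : ℤ) : ZMod Sd).val : ℤ) = (e.1 - -x) 0 := by
      rw [ZMod.val_intCast, Int.emod_eq_of_lt (by omega) (by omega)]
    simp only [Set.mem_setOf_eq, torusEdge, Torus.proj_apply]
    constructor <;> omega
  rw [hO]

omit [Group G] in
/-- **Translation.** If `g` is supported in the slab `lo ≤ x⁰ ≤ hi`, `0 ≤ lo`, and the translated
slab still fits, `hi + a s ≤ a R`, then smearing `T_{a s} g` over the box `{-R,…,R}⁴` against the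
lift of `U` is smearing `g` against the lift of `τ_s U`. [cite: OsterwalderSeiler1978, §2] -/
theorem smearedLatticeField_translateTest_torusLift (O : LGConfig 4 G → ℝ) (R : ℕ) {a : ℝ}
    (ha : 0 < a) (c m : ℝ) {g : 𝓢(EuclideanSpace ℝ (Fin 4), ℝ)} {lo hi : ℝ} (hlo : 0 ≤ lo)
    (hsupp : tsupport (g : EuclideanSpace ℝ (Fin 4) → ℝ) ⊆ {x | lo ≤ x 0 ∧ x 0 ≤ hi}) {s : ℕ}
    (hfit : hi + a * s ≤ a * R) {Sd : ℕ} (U : GaugeConfig 4 Sd G) :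
    smearedLatticeField O (box 4 R) a c m (translateTest (EuclideanSpace.single 0 (a * s)) g)
        (torusLift Sd U) =
      smearedLatticeField O (box 4 R) a c m g (torusLift Sd (timeShift Sd s U)) := by
  rw [torusLift_timeShift]
  simp only [smearedLatticeField]
  refine congrArg (fun z : ℝ => c * a ^ 4 * z) ?_
  set e : Literature.Probability.LatticeModels.Site 4 := Pi.single 0 (s : ℤ) with he
  set W := torusLift Sd U
  have hpt : ∀ x : Literature.Probability.LatticeModels.Site 4,
      a • siteToE x - EuclideanSpace.single (0 : Fin 4) (a * (s : ℝ)) = a • siteToE (x - e) := by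
    intro x
    ext i
    by_cases hi : i = 0
    · subst hi
      simp [he, mul_sub]
    · simp [he, hi]
  have hshift : ∀ y : Literature.Probability.LatticeModels.Site 4,
      configShift (-y) (configShift (-e) W) = configShift (-(y + e)) W := by
    intro y
    funext q
    simp only [configShift_apply, sub_neg_eq_add, add_assoc]
  simp_rw [translateTest_apply, hpt, hshift]
  have key : ∀ y : Literature.Probability.LatticeModels.Site 4, g (a • siteToE y) ≠ 0 →
      (0 : ℤ) ≤ y 0 ∧ y 0 + s ≤ R := by
    intro y hy
    have hy' := hsupp (subset_tsupport _ (Function.mem_support.2 hy))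
    simp only [Set.mem_setOf_eq, PiLp.smul_apply, siteToE_apply, smul_eq_mul] at hy'
    have h1 : (0 : ℝ) ≤ y 0 := le_of_mul_le_mul_left (by nlinarith [hy'.1]) ha
    have h2 : (y 0 : ℝ) + s ≤ R := le_of_mul_le_mul_left (by nlinarith [hy'.2]) ha
    exact ⟨by exact_mod_cast h1, by exact_mod_cast h2⟩
  have memiff : ∀ y : Literature.Probability.LatticeModels.Site 4, g (a • siteToE y) ≠ 0 →
      (y ∈ box 4 R ↔ y + e ∈ box 4 R) := by
    intro y hy
    obtain ⟨h0, h1⟩ := key y hy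
    simp only [mem_box]
    refine forall_congr' fun i => ?_
    by_cases hi : i = 0
    · subst hi
      simp only [Pi.add_apply, he, Pi.single_eq_same]
      omega
    · simp [he, hi]
  refine Finset.sum_bij_ne_zero (fun x _ _ => x - e) (fun x hx hne => ?_)
    (fun x₁ _ _ x₂ _ _ h => sub_left_inj.1 h) (fun y hy hne => ?_) (fun x _ _ => ?_)
  · have hg : g (a • siteToE (x - e)) ≠ 0 := left_ne_zero_of_mul hne
    exact (memiff _ hg).2 (by rwa [sub_add_cancel])
  · refine ⟨y + e, (memiff _ (left_ne_zero_of_mul hne)).1 hy, ?_, add_sub_cancel_right y e⟩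
    rwa [add_sub_cancel_right]
  · rw [sub_add_cancel]

variable [MeasurableInv G]

/-- **Reflection** (symmetric renormalisations): `Φ^{s}(θf)(Ũ) = Φ^{Θs}(f)((Θ'U)~)` — the field of
`s` smeared with `θf` is the field of `Θs` smeared with `f` on the reflected configuration. [cite: OsterwalderSeiler1978, §2] -/
theorem smearedLatticeField_thetaTest_torusLift {S : SpeciesScheme (YMSpecies G)}
    (hsym : S.IsReflectionSymmetric) (s : YMSpecies G) (k : ℕ)
    (f : 𝓢(EuclideanSpace ℝ (Fin 4), ℝ)) (U : GaugeConfig 4 (S.side k) G) :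
    smearedLatticeField s.F (box 4 (S.L k)) (S.a k) (S.c s k) (S.m s k) (thetaTest 4 f)
        (torusLift (S.side k) U) =
      smearedLatticeField s.timeReflect.F (box 4 (S.L k)) (S.a k) (S.c s.timeReflect k)
        (S.m s.timeReflect k) f (torusLift (S.side k) U.negReflect) := by
  rw [smearedLatticeField_thetaTest, torusLift_negReflect, (hsym s k).1, (hsym s k).2]
  rfl

/-- The reflected block of a lattice Schwinger integrand: the product over the reversed, reflected
species string against the reflected test functions is `obsProd S k σ f` read on `Θ'U`.
[cite: OsterwalderSeiler1978, §2] -/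
theorem prod_smearedLatticeField_reflected {S : SpeciesScheme (YMSpecies G)}
    (hsym : S.IsReflectionSymmetric) (k : ℕ) {n : ℕ} (σ : Fin n → YMSpecies G)
    (f : Fin n → 𝓢(EuclideanSpace ℝ (Fin 4), ℝ)) (U : GaugeConfig 4 (S.side k) G) :
    ∏ i : Fin n, smearedLatticeField (σ (Fin.rev i)).timeReflect.F (box 4 (S.L k)) (S.a k)
        (S.c (σ (Fin.rev i)).timeReflect k) (S.m (σ (Fin.rev i)).timeReflect k)
        (thetaTest 4 (f (Fin.rev i))) (torusLift (S.side k) U) =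
      obsProd S k σ f U.negReflect := by
  rw [obsProd]
  refine Fintype.prod_equiv Fin.revPerm _ _ fun i => ?_
  rw [Fin.revPerm_apply, smearedLatticeField_thetaTest_torusLift hsym]
  simp only [LocalGaugeObservable.timeReflect_timeReflect]

end Obs

/-! ## §2 Limits along `IsYangMillsFor` -/

section Limits

variable {G : Type} [Group G] [TopologicalSpace G] [IsTopologicalGroup G] [CompactSpace G]
  [MeasurableSpace G] [BorelSpace G]

/-- **Lattice Schwinger functions converge on off-diagonal real product tensors** (all degrees:
`IsYangMillsFor` for `n ≥ 1`, E0 and `μ_k(1) = 1` for `n = 0`). [cite: JaffeWitten2000, §6] -/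
theorem tendsto_latticeSchwinger (r : LatticeRep G) {S : SpeciesScheme (YMSpecies G)}
    {T : OSData (YMSpecies G) 4} (hT : IsYangMillsFor r S T) {N : ℕ} (σ : Fin N → YMSpecies G)
    (f : Fin N → 𝓢(EuclideanSpace ℝ (Fin 4), ℝ)) {P : 𝓢((Fin N → EuclideanSpace ℝ (Fin 4)), ℂ)}
    (hP : IsTensorOf P fun i => ofRealTest (f i)) (hoff : IsOffDiagonal P) :
    Tendsto (fun k => ((latticeSchwinger r.ρ S (fun s => s.F) k N σ f : ℝ) : ℂ)) atTop
      (𝓝 (T.schwinger N σ P)) := by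
  rcases Nat.eq_zero_or_pos N with rfl | hN
  · have h1 : T.schwinger 0 σ P = 1 := by rw [T.normalized σ P, hP]; simp
    have h2 : ∀ k, latticeSchwinger r.ρ S (fun s => s.F) k 0 σ f = 1 := fun k => by
      haveI := isProbabilityMeasure_wilsonMeasure (d := 4) (L := S.side k) r.ρ r.continuous (S.β k)
      simp [latticeSchwinger]
    rw [h1]
    simp only [h2, Complex.ofReal_one]
    exact tendsto_const_nhds
  · exact hT N hN.ne' σ f P hP hoff

/-- The OS adjoint `ΘP*` of a slab-ordered real product tensor is off-diagonal (its factors live in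
the pairwise disjoint reflected slabs). [cite: OsterwalderSchraderCMP1973, §2 (2.4)] -/
theorem isOffDiagonal_osAdjoint_of_slabs {n : ℕ} {P : 𝓢((Fin n → EuclideanSpace ℝ (Fin 4)), ℂ)}
    {f : Fin n → 𝓢(EuclideanSpace ℝ (Fin 4), ℝ)} (hP : IsTensorOf P fun i => ofRealTest (f i))
    {lo hi : Fin n → ℝ} (hord : ∀ i j, i < j → hi i < lo j)
    (hsupp : ∀ i, tsupport (f i : EuclideanSpace ℝ (Fin 4) → ℝ) ⊆ {x | lo i ≤ x 0 ∧ x 0 ≤ hi i}) :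
    IsOffDiagonal (osAdjoint P) := by
  have hT := hP.osAdjoint
  refine IsOffDiagonal.of_tsupport_subset fun x hx => ?_
  have hxi : ∀ i, lo (Fin.rev i) ≤ -x i 0 ∧ -x i 0 ≤ hi (Fin.rev i) := fun i => by
    have hmem := tsupport_ofRealTest_subset _ (hT.tsupport_subset hx i)
    have h1 := hsupp (Fin.rev i) (tsupport_thetaTest_subset _ hmem)
    rw [Set.mem_setOf_eq, timeReflection_apply, if_pos rfl] at h1
    exact h1
  refine not_mem_coincidenceLocus_of_injective fun i j hij => ?_
  by_contra hne
  have h0 : x i 0 = x j 0 := by rw [hij]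
  rcases lt_or_gt_of_ne hne with hlt | hlt
  · linarith [(hxi i).1, (hxi j).2, hord _ _ (Fin.rev_lt_rev.2 hlt)]
  · linarith [(hxi j).1, (hxi i).2, hord _ _ (Fin.rev_lt_rev.2 hlt)]

/-- **One-point limit**: `∫ obsProd S k σ' g dμ_k → 𝔖_m^{σ'}(Q)` for a slab-ordered real product
tensor `Q = ⊗ⱼ gⱼ`. [cite: JaffeWitten2000, §6] -/
theorem tendsto_integral_obsProd (r : LatticeRep G) {S : SpeciesScheme (YMSpecies G)}
    {T : OSData (YMSpecies G) 4} (hT : IsYangMillsFor r S T) {m : ℕ} (σ' : Fin m → YMSpecies G)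
    {Q : 𝓢((Fin m → EuclideanSpace ℝ (Fin 4)), ℂ)} {g : Fin m → 𝓢(EuclideanSpace ℝ (Fin 4), ℝ)}
    (hQ : IsTensorOf Q fun j => ofRealTest (g j)) {lo' hi' : Fin m → ℝ} (hlo' : ∀ j, 0 < lo' j)
    (hord' : ∀ i j, i < j → hi' i < lo' j)
    (hsupp' : ∀ j, tsupport (g j : EuclideanSpace ℝ (Fin 4) → ℝ) ⊆ {x | lo' j ≤ x 0 ∧ x 0 ≤ hi' j}) :
    Tendsto (fun k => ∫ U, ((obsProd S k σ' g U : ℝ) : ℂ) ∂(wilsonMeasure r.ρ (S.β k))) atTop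
      (𝓝 (T.schwinger m σ' Q)) := by
  refine (tendsto_latticeSchwinger r hT σ' g hQ
    (isTimeOrdered_of_isTensorOf_slabs hQ hlo' hord' hsupp').isOffDiagonal).congr fun k => ?_
  rw [integral_complex_ofReal]
  rfl

variable {S : SpeciesScheme (YMSpecies G)}

/-- **Reflected one-point limit**: `∫ obsProd S k σ f dμ_k → 𝔖_n^{Θσ ∘ rev}(ΘP*)` (by
`Θ'`-invariance of Wilson's measure and the reflection identity the integral is the lattice
Schwinger function whose tensor is the off-diagonal OS adjoint `ΘP*`). [cite: OsterwalderSeiler1978, §2] -/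
theorem tendsto_integral_obsProd_reflected (r : LatticeRep G) {T : OSData (YMSpecies G) 4}
    (hT : IsYangMillsFor r S T) (hsym : S.IsReflectionSymmetric) {n : ℕ} (σ : Fin n → YMSpecies G)
    {P : 𝓢((Fin n → EuclideanSpace ℝ (Fin 4)), ℂ)} {f : Fin n → 𝓢(EuclideanSpace ℝ (Fin 4), ℝ)}
    (hP : IsTensorOf P fun i => ofRealTest (f i)) {lo hi : Fin n → ℝ}
    (hord : ∀ i j, i < j → hi i < lo j)
    (hsupp : ∀ i, tsupport (f i : EuclideanSpace ℝ (Fin 4) → ℝ) ⊆ {x | lo i ≤ x 0 ∧ x 0 ≤ hi i}) :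
    Tendsto (fun k => ∫ U, ((obsProd S k σ f U : ℝ) : ℂ) ∂(wilsonMeasure r.ρ (S.β k))) atTop
      (𝓝 (T.schwinger n ((fun i => (σ i).timeReflect) ∘ Fin.rev) (osAdjoint P))) := by
  refine (tendsto_latticeSchwinger r hT ((fun i => (σ i).timeReflect) ∘ Fin.rev)
    (fun i => thetaTest 4 (f (Fin.rev i))) hP.osAdjoint
    (isOffDiagonal_osAdjoint_of_slabs hP hord hsupp)).congr fun k => ?_
  rw [integral_complex_ofReal, latticeSchwinger,
    ← integral_comp_negReflect_eq r.ρ r.continuous (S.β k) (obsProd S k σ f)]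
  congr 1
  refine integral_congr_ae (Eventually.of_forall fun U => ?_)
  exact prod_smearedLatticeField_reflected hsym k σ f U

/-- **Reflected–translated two-point limit** for slab-ordered real product tensors `P = ⊗ fᵢ`
(lattice species `σ`), `Q = ⊗ gⱼ` (species `σ'`), `t ≥ 0`, shifts `s_k` with `a_k s_k = t`
eventually: `∫ obsProd σ f (Θ'U) · obsProd σ' g (τ_{s_k} U) dμ_k → 𝔖_{n+m}^{Θσ∘rev ++ σ'}(ΘP* ⊗ T_t Q)`
(eventually the integral IS the lattice Schwinger function of the append tensor, an off-diagonal
real product tensor on which `IsYangMillsFor` gives convergence). [cite: OsterwalderSeiler1978, §2] -/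
theorem tendsto_integral_obsProd_reflect_mul_shift (r : LatticeRep G) {S : SpeciesScheme (YMSpecies G)}
    {T : OSData (YMSpecies G) 4} (hT : IsYangMillsFor r S T) (hsym : S.IsReflectionSymmetric) {n m : ℕ}
    (σ : Fin n → YMSpecies G) (σ' : Fin m → YMSpecies G)
    {P : 𝓢((Fin n → EuclideanSpace ℝ (Fin 4)), ℂ)} {Q : 𝓢((Fin m → EuclideanSpace ℝ (Fin 4)), ℂ)}
    {f : Fin n → 𝓢(EuclideanSpace ℝ (Fin 4), ℝ)} {g : Fin m → 𝓢(EuclideanSpace ℝ (Fin 4), ℝ)}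
    (hP : IsTensorOf P fun i => ofRealTest (f i)) (hQ : IsTensorOf Q fun j => ofRealTest (g j))
    {lo hi : Fin n → ℝ} {lo' hi' : Fin m → ℝ} (hlo : ∀ i, 0 < lo i) (hlo' : ∀ j, 0 < lo' j)
    (hord : ∀ i j, i < j → hi i < lo j) (hord' : ∀ i j, i < j → hi' i < lo' j)
    (hsupp : ∀ i, tsupport (f i : EuclideanSpace ℝ (Fin 4) → ℝ) ⊆ {x | lo i ≤ x 0 ∧ x 0 ≤ hi i})
    (hsupp' : ∀ j, tsupport (g j : EuclideanSpace ℝ (Fin 4) → ℝ) ⊆ {x | lo' j ≤ x 0 ∧ x 0 ≤ hi' j})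
    {t : ℝ} (ht : 0 ≤ t) {s : ℕ → ℕ} (hs : ∀ᶠ k in atTop, S.a k * (s k : ℝ) = t) :
    Tendsto (fun k => ∫ U, conj ((obsProd S k σ f U.negReflect : ℝ) : ℂ) *
        ((obsProd S k σ' g (timeShift (S.side k) (s k) U) : ℝ) : ℂ) ∂(wilsonMeasure r.ρ (S.β k)))
      atTop (𝓝 (T.schwinger (n + m) (Fin.append ((fun i => (σ i).timeReflect) ∘ Fin.rev) σ')
        ((osAdjoint P).appendTensor (translateMulti (EuclideanSpace.single 0 t) Q)))) := by
  have hlim := tendsto_latticeSchwinger r hT (Fin.append ((fun i => (σ i).timeReflect) ∘ Fin.rev) σ')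
    _ (isTensorOf_osAdjoint_appendTensor_translateMulti hP hQ (EuclideanSpace.single 0 t))
    (isOffDiagonal_osAdjoint_appendTensor_translateMulti_of_slabs hP hQ hlo hlo' hord hord' hsupp
      hsupp' ht)
  refine hlim.congr' ?_
  have hfit : ∀ᶠ k in atTop, ∀ j, hi' j + t ≤ S.a k * S.L k :=
    eventually_all.2 fun j => S.tendsto_L.eventually_ge_atTop _
  filter_upwards [hs, hfit] with k hk hfk
  simp_rw [Complex.conj_ofReal, ← Complex.ofReal_mul]
  rw [integral_complex_ofReal, latticeSchwinger]
  congr 1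
  refine integral_congr_ae (Eventually.of_forall fun U => ?_)
  dsimp only
  rw [Fin.prod_univ_add]
  simp only [Fin.append_left, Fin.append_right, Function.comp_apply]
  rw [prod_smearedLatticeField_reflected hsym k σ f U, obsProd]
  congr 1
  refine Finset.prod_congr rfl fun j _ => ?_
  rw [← hk]
  exact smearedLatticeField_translateTest_torusLift _ _ (S.a_pos k) _ _ (hlo' j).le (hsupp' j)
    (by rw [hk]; exact hfk j) U

end Limits

end Transfer

end Summit.QuantumFields.YangMills.Cruxes.LatticeGapOnTrajectory.OrbitKantorovichFiniteSize

end
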